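import Summits.CriticalPhenomena.CardyFormulaZ2.Theses.ModulusResponse
import Summits.CriticalPhenomena.CardyFormulaZ2.Theorems.ModulusResponseSmirnovResponseStubAnchorLimits
import Summits.CriticalPhenomena.CardyFormulaZ2.Theorems.ModulusResponseSmirnovResponseStubStretchedRectangle
import Summits.CriticalPhenomena.CardyFormulaZ2.Theorems.ModulusResponseSmirnovResponseStubRussoDefectForm
import HarnessLib

/-!
# Crux `SmirnovResponse` (stmt-CriticalPhenomena-6468) — the strategist's typed split (glue for `route edit --split`)

Route `ModulusResponse` of `CriticalPhenomena/CardyFormulaZ2`, crux `SmirnovResponse` (rank 2: the `u`-response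
of the crossing probability at `u = 0` in the self-dual cell family `μ_u`, along `δ → 0⁺`, converges to `k · L`
where `L` is the `t`-derivative of the scaling limit under the pinned diagonal stretches
`S_t z = cosh t · z + i sinh t · z̄`, with ONE constant `k` for all conformal rectangles).

The registered line `Cruxes/SmirnovResponse/Lines/birth.lean` (kernel v2) reduces the crux to two open stubs at
Smirnov's point `t₀ = -(log 3)/4` (where `S_{t₀}(ℤ²)` carries the `u = 0` model onto critical site percolation on
the triangular lattice, `SmirnovCellAnchor`, closed):

* CHILD `DefectSumTight` (first hypothesis below, verbatim the registered `stub_defectSumTight`): for every conformal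
  rectangle `R` the Russo defect sums `Σᶠ_m (μ_0[ω Δ {v_m} ∈ C_δ(S_{t₀} R)] - μ_0[C_δ(S_{t₀} R)])` stay bounded as
  `δ → 0⁺` (termwise `δ⁻²` cells × four-arm probability `δ^{5/4}`: the claim is the cancellation of the leading
  `δ^{-3/4}` in the antisymmetric channel — marginality of the stretching perturbation).
* CHILD `DefectSumClusterValue` (second hypothesis, verbatim the registered `stub_defectSumClusterValue`): ONE
  constant `k` such that for every `R`, every honest limit function `P` of the stretched crossing probabilities
  with derivative `L` at `t₀`, every cluster value `ρ` of the defect sums equals `k · L` (identification of the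
  response with the infinitesimal stretch `∂_t`, i.e. with the `T + T̄` channel).

THEOREM `smirnovResponse_of_defectSum : DefectSumTight → DefectSumClusterValue → SmirnovResponse` (sorry-free; the two
hypotheses are spelled out because the child items do not exist yet). Proof = the glue of the birth skeleton with the
three CLOSED stubs used by name: `stub_russoDefectForm` (p149590: for `δ > 0` the right `u`-derivative at `0` IS the
defect sum, hence `derivWithin … (Ici 0) 0 = finsum …`), `stub_stretchedRectangle` (p148478: `S_{t₀} R' = S_t R` for
`R' = S_{t - t₀} R`, on carrier and arcs — transports both children from `t₀` to every pre-stretch `t`),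
`stub_anchorLimits` (p146613: the `limUnder` in the crux is an honest limit), and
`IsCompact.tendsto_nhds_of_unique_mapClusterPt` on `[-C, C]` (a bounded real net with a unique cluster value converges).

Recorded by the crux-strategist seat (`Cruxes/SmirnovResponse/STRATEGY-CENSUS.md`): transfer / strengthen / negation
give no leverage on either child; the split makes the two open pieces first-class items (T is also the boundedness
half of `FirstOrderAtSmirnovPoint` of route `CardySelfDualSegment`).
-/

noncomputable section

namespace Summit.CriticalPhenomena.CardyFormulaZ2.Theorems

namespace SmirnovResponseSplit

open scoped Topology

/-- For `δ > 0` the finite-mesh right `u`-derivative IS the defect sum (`stub_russoDefectForm` + uniqueness of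
one-sided derivatives on `[0, ∞)`). -/
theorem derivWithin_eq_defectSum (μ : ℝ → MeasureTheory.Measure (Literature.Probability.Percolation.BondConfig (Literature.Probability.LatticeModels.Site 2))) (S : ℝ → ℂ → ℂ)
    (hμ : ∀ u, μ u = MeasureTheory.Measure.map (fun p : Set (Literature.Probability.LatticeModels.Site 2) × Set (Literature.Probability.LatticeModels.Site 2) ↦ {e | ∃ m, (m ∈ p.1 ∧ e = s(m - Pi.single 0 1, m)) ∨ ((m ∈ p.1 ↔ m ∉ p.2) ∧ e = s(m - Pi.single 1 1, m))}) ((ProbabilityTheory.setBernoulli Set.univ Literature.Probability.Percolation.half).prod (ProbabilityTheory.setBernoulli Set.univ (Set.projIcc 0 1 zero_le_one u))))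
    (hS : ∀ t z, S t z = (Real.cosh t : ℂ) * z + Complex.I * (Real.sinh t : ℂ) * (starRingEnd ℂ) z)
    (R : Literature.Probability.RandomPlanarGeometry.ConformalRectangle) (t : ℝ) {δ : ℝ} (hδ : 0 < δ) :
    derivWithin (fun u ↦ (μ u).real (Literature.Probability.Percolation.discreteCrossing (S t '' R.carrier) δ (S t '' R.arc 0) (S t '' R.arc 2))) (Set.Ici 0) 0 = finsum (fun m : Literature.Probability.LatticeModels.Site 2 ↦ (μ 0).real ((fun ω ↦ symmDiff ω {s(m - Pi.single 1 1, m)}) ⁻¹' Literature.Probability.Percolation.discreteCrossing (S t '' R.carrier) δ (S t '' R.arc 0) (S t '' R.arc 2)) - (μ 0).real (Literature.Probability.Percolation.discreteCrossing (S t '' R.carrier) δ (S t '' R.arc 0) (S t '' R.arc 2))) :=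
  (stub_russoDefectForm μ S hμ hS R t δ hδ).derivWithin (uniqueDiffWithinAt_Ici 0)

/-- The finite-mesh derivatives and the defect sums agree eventually along `δ → 0⁺`. -/
theorem derivWithin_eventuallyEq_defectSum (μ : ℝ → MeasureTheory.Measure (Literature.Probability.Percolation.BondConfig (Literature.Probability.LatticeModels.Site 2))) (S : ℝ → ℂ → ℂ)
    (hμ : ∀ u, μ u = MeasureTheory.Measure.map (fun p : Set (Literature.Probability.LatticeModels.Site 2) × Set (Literature.Probability.LatticeModels.Site 2) ↦ {e | ∃ m, (m ∈ p.1 ∧ e = s(m - Pi.single 0 1, m)) ∨ ((m ∈ p.1 ↔ m ∉ p.2) ∧ e = s(m - Pi.single 1 1, m))}) ((ProbabilityTheory.setBernoulli Set.univ Literature.Probability.Percolation.half).prod (ProbabilityTheory.setBernoulli Set.univ (Set.projIcc 0 1 zero_le_one u))))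
    (hS : ∀ t z, S t z = (Real.cosh t : ℂ) * z + Complex.I * (Real.sinh t : ℂ) * (starRingEnd ℂ) z)
    (R : Literature.Probability.RandomPlanarGeometry.ConformalRectangle) (t : ℝ) :
    (fun δ ↦ derivWithin (fun u ↦ (μ u).real (Literature.Probability.Percolation.discreteCrossing (S t '' R.carrier) δ (S t '' R.arc 0) (S t '' R.arc 2))) (Set.Ici 0) 0) =ᶠ[nhdsWithin (0 : ℝ) (Set.Ioi 0)] (fun δ ↦ finsum (fun m : Literature.Probability.LatticeModels.Site 2 ↦ (μ 0).real ((fun ω ↦ symmDiff ω {s(m - Pi.single 1 1, m)}) ⁻¹' Literature.Probability.Percolation.discreteCrossing (S t '' R.carrier) δ (S t '' R.arc 0) (S t '' R.arc 2)) - (μ 0).real (Literature.Probability.Percolation.discreteCrossing (S t '' R.carrier) δ (S t '' R.arc 0) (S t '' R.arc 2)))) :=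
  eventually_nhdsWithin_of_forall fun _ hδ ↦ derivWithin_eq_defectSum μ S hμ hS R t hδ

end SmirnovResponseSplit

open scoped Topology
open SmirnovResponseSplit

/-- **`SmirnovResponse` (stmt-CriticalPhenomena-6468) from the two defect-sum pieces at Smirnov's point** — the glue of
the split `DefectSumTight → DefectSumClusterValue → SmirnovResponse` (hypotheses spelled out; they are verbatim the
registered stubs `stub_defectSumTight`, `stub_defectSumClusterValue` of `Cruxes/SmirnovResponse/Lines/birth.lean` and the
bodies of the two child items). Transport from `t₀ = -(log 3)/4` to a general pre-stretch `t` by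
`stub_stretchedRectangle`; finite-mesh derivative = defect sum by `stub_russoDefectForm`; honest limits by
`stub_anchorLimits`; convergence of a bounded real net with a unique cluster value. [folklore] -/
theorem smirnovResponse_of_defectSum : (∀ (μ : ℝ → MeasureTheory.Measure (Literature.Probability.Percolation.BondConfig (Literature.Probability.LatticeModels.Site 2))) (S : ℝ → ℂ → ℂ), (∀ u, μ u = MeasureTheory.Measure.map (fun p : Set (Literature.Probability.LatticeModels.Site 2) × Set (Literature.Probability.LatticeModels.Site 2) ↦ {e | ∃ m, (m ∈ p.1 ∧ e = s(m - Pi.single 0 1, m)) ∨ ((m ∈ p.1 ↔ m ∉ p.2) ∧ e = s(m - Pi.single 1 1, m))}) ((ProbabilityTheory.setBernoulli Set.univ Literature.Probability.Percolation.half).prod (ProbabilityTheory.setBernoulli Set.univ (Set.projIcc 0 1 zero_le_one u)))) → (∀ t z, S t z = (Real.cosh t : ℂ) * z + Complex.I * (Real.sinh t : ℂ) * (starRingEnd ℂ) z) → ∀ (R : Literature.Probability.RandomPlanarGeometry.ConformalRectangle), ∃ C : ℝ, ∀ᶠ δ in nhdsWithin (0 : ℝ) (Set.Ioi 0), |finsum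 (fun m : Literature.Probability.LatticeModels.Site 2 ↦ (μ 0).real ((fun ω ↦ symmDiff ω {s(m - Pi.single 1 1, m)}) ⁻¹' Literature.Probability.Percolation.discreteCrossing (S (-(Real.log 3) / 4) '' R.carrier) δ (S (-(Real.log 3) / 4) '' R.arc 0) (S (-(Real.log 3) / 4) '' R.arc 2)) - (μ 0).real (Literature.Probability.Percolation.discreteCrossing (S (-(Real.log 3) / 4) '' R.carrier) δ (S (-(Real.log 3) / 4) '' R.arc 0) (S (-(Real.log 3) / 4) '' R.arc 2)))| ≤ C) → (∀ (μ : ℝ → MeasureTheory.Measure (Literature.Probability.Percolation.BondConfig (Literature.Probability.LatticeModels.Site 2))) (S : ℝ → ℂ → ℂ), (∀ u, μ u = MeasureTheory.Measure.map (fun p : Set (Literature.Probability.LatticeModels.Site 2) × Set (Literature.Probability.LatticeModels.Site 2) ↦ {e | ∃ m, (m ∈ p.1 ∧ e = s(m - Pi.single 0 1, m)) ∨ ((m ∈ p.1 ↔ m ∉ p.2) ∧ e = s(m - Pi.single 1 1, m))}) ((ProbabilityTheory.setBernoulli Set.univ Literature.Probability.Percolation.half).prod (ProbabilityTheory.setBernoulli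 Set.univ (Set.projIcc 0 1 zero_le_one u)))) → (∀ t z, S t z = (Real.cosh t : ℂ) * z + Complex.I * (Real.sinh t : ℂ) * (starRingEnd ℂ) z) → ∃ k : ℝ, ∀ (R : Literature.Probability.RandomPlanarGeometry.ConformalRectangle) (P : ℝ → ℝ) (L ρ : ℝ), (∀ s : ℝ, Filter.Tendsto (fun δ ↦ (μ 0).real (Literature.Probability.Percolation.discreteCrossing (S s '' R.carrier) δ (S s '' R.arc 0) (S s '' R.arc 2))) (nhdsWithin 0 (Set.Ioi 0)) (nhds (P s))) → HasDerivAt P L (-(Real.log 3) / 4) → MapClusterPt ρ (nhdsWithin (0 : ℝ) (Set.Ioi 0)) (fun δ ↦ finsum (fun m : Literature.Probability.LatticeModels.Site 2 ↦ (μ 0).real ((fun ω ↦ symmDiff ω {s(m - Pi.single 1 1, m)}) ⁻¹' Literature.Probability.Percolation.discreteCrossing (S (-(Real.log 3) / 4) '' R.carrier) δ (S (-(Real.log 3) / 4) '' R.arc 0) (S (-(Real.log 3) / 4) '' R.arc 2)) - (μ 0).real (Literature.Probability.Percolation.discreteCrossing (S (-(Real.log 3) / 4) '' R.carrier) δ (S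 (-(Real.log 3) / 4) '' R.arc 0) (S (-(Real.log 3) / 4) '' R.arc 2)))) → ρ = k * L) → Summit.CriticalPhenomena.CardyFormulaZ2.Theses.ModulusResponse.SmirnovResponse := by
  intro hT hI μ S hμ hS
  -- CLUSTER-VALUE IDENTIFICATION at every pre-stretch `t`, transported from `t₀` (child 2 + stubs 2, 3)
  obtain ⟨k, hk⟩ := hI μ S hμ hS
  have hkt : ∀ (R : Literature.Probability.RandomPlanarGeometry.ConformalRectangle) (P : ℝ → ℝ) (t L ρ : ℝ),
      (∀ s : ℝ, Filter.Tendsto (fun δ ↦ (μ 0).real (Literature.Probability.Percolation.discreteCrossing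
        (S s '' R.carrier) δ (S s '' R.arc 0) (S s '' R.arc 2))) (nhdsWithin 0 (Set.Ioi 0)) (nhds (P s))) →
      HasDerivAt P L t →
      MapClusterPt ρ (nhdsWithin (0 : ℝ) (Set.Ioi 0)) (fun δ ↦ derivWithin (fun u ↦ (μ u).real
        (Literature.Probability.Percolation.discreteCrossing (S t '' R.carrier) δ (S t '' R.arc 0)
          (S t '' R.arc 2))) (Set.Ici 0) 0) → ρ = k * L := by
    intro R P t L ρ hP hL hρ
    obtain ⟨R', hR'⟩ := stub_stretchedRectangle S hS R (t - (-(Real.log 3) / 4))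
    have ht : -(Real.log 3) / 4 + (t - (-(Real.log 3) / 4)) = t := by ring
    refine hk R' (fun s ↦ P (s + (t - (-(Real.log 3) / 4)))) L ρ (fun s ↦ ?_) ?_ ?_
    · rw [(hR' s).1, (hR' s).2 0, (hR' s).2 2]
      exact hP _
    · have ht' : t = -(Real.log 3) / 4 + (t - (-(Real.log 3) / 4)) := by ring
      rw [ht'] at hL
      exact hL.comp_add_const _ _
    · have hev := derivWithin_eventuallyEq_defectSum μ S hμ hS R' (-(Real.log 3) / 4)
      rw [(hR' (-(Real.log 3) / 4)).1, (hR' (-(Real.log 3) / 4)).2 0, (hR' (-(Real.log 3) / 4)).2 2, ht] at hev ⊢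
      unfold MapClusterPt at hρ ⊢
      rwa [← Filter.map_congr hev]
  refine ⟨k, fun R t L hL ↦ ?_⟩
  -- RESPONSE TIGHTNESS at the pre-stretch `t`, transported from `t₀` (child 1 + stubs 2, 3)
  obtain ⟨C, hC⟩ : ∃ C : ℝ, ∀ᶠ δ in nhdsWithin (0 : ℝ) (Set.Ioi 0), |derivWithin (fun u ↦ (μ u).real
      (Literature.Probability.Percolation.discreteCrossing (S t '' R.carrier) δ (S t '' R.arc 0) (S t '' R.arc 2)))
        (Set.Ici 0) 0| ≤ C := by
    obtain ⟨R', hR'⟩ := stub_stretchedRectangle S hS R (t - (-(Real.log 3) / 4))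
    obtain ⟨C, hC⟩ := hT μ S hμ hS R'
    refine ⟨C, ?_⟩
    have ht : -(Real.log 3) / 4 + (t - (-(Real.log 3) / 4)) = t := by ring
    have hev := derivWithin_eventuallyEq_defectSum μ S hμ hS R' (-(Real.log 3) / 4)
    rw [(hR' (-(Real.log 3) / 4)).1, (hR' (-(Real.log 3) / 4)).2 0, (hR' (-(Real.log 3) / 4)).2 2, ht] at hev hC
    filter_upwards [hev, hC] with δ hδ hCδ
    rw [hδ]
    exact hCδ
  -- stub 1: the `limUnder` in the crux is an honest limit, for every stretch parameter `s`
  have hP : ∀ s : ℝ, Filter.Tendsto (fun δ ↦ (μ 0).real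
      (Literature.Probability.Percolation.discreteCrossing (S s '' R.carrier) δ (S s '' R.arc 0)
        (S s '' R.arc 2))) (nhdsWithin 0 (Set.Ioi 0))
      (nhds (Filter.limUnder (nhdsWithin (0 : ℝ) (Set.Ioi 0)) (fun δ ↦ (μ 0).real
        (Literature.Probability.Percolation.discreteCrossing (S s '' R.carrier) δ (S s '' R.arc 0)
          (S s '' R.arc 2))))) :=
    fun s ↦ tendsto_nhds_limUnder (stub_anchorLimits μ S hμ hS R s)
  -- the responses eventually lie in the compact interval `[-C, C]`
  have hmem : ∀ᶠ δ in nhdsWithin (0 : ℝ) (Set.Ioi 0),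
      derivWithin (fun u ↦ (μ u).real (Literature.Probability.Percolation.discreteCrossing
        (S t '' R.carrier) δ (S t '' R.arc 0) (S t '' R.arc 2))) (Set.Ici 0) 0 ∈ Set.Icc (-C) C :=
    hC.mono fun δ hδ ↦ Set.mem_Icc.mpr (abs_le.mp hδ)
  -- a bounded real net all of whose cluster values equal `k * L` converges to `k * L`
  refine (isCompact_Icc : IsCompact (Set.Icc (-C) C)).tendsto_nhds_of_unique_mapClusterPt hmem ?_
  intro ρ _ hρ
  exact hkt R (fun s ↦ Filter.limUnder (nhdsWithin (0 : ℝ) (Set.Ioi 0)) (fun δ ↦ (μ 0).real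
    (Literature.Probability.Percolation.discreteCrossing (S s '' R.carrier) δ (S s '' R.arc 0)
      (S s '' R.arc 2)))) t L ρ hP hL hρ

end Summit.CriticalPhenomena.CardyFormulaZ2.Theorems

end
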